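import Summits.HodgeConjecture.CorCM.Census.CoinvariantCyclic

/-!
# The coinvariant fibre `φ₂(G, c)`, VII: the split-cyclic toolkit — `G = ⟨g⟩ ⊔ c⟨g⟩`: the subgroup type, the half-interval type,
# the augmentation submodule modulo pairs, `|G| = 2·ord g`, `δ = 1`

COR-CM (cell `pub-hodgecm2`), count-neutral kernel combinatorics by the binder seat b09 (gen 29; lane COINVARIANT-FLOOR),
part VII, sequel of `Census/CoinvariantCyclic.lean` (VI); the toolkit for part VIII (`Census/CoinvariantSplitCyclic.lean`:
`φ₂ + 2 = β` when `G = ⟨g⟩ ⊔ c⟨g⟩`, `ord g` even).  Theorems + two bookkeeping definitions (`sgp`, the subgroup type `[⟨g⟩]`;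
`hivl`, the half-interval type); the split hypothesis is carried as two plain binders `hcov : ∀ Q, Q = g^k ∨ Q = c·g^k` and
`hng : c ≠ g^k`; no `decide` beyond numerals of `ZMod 2`, no certificate, no named fact, no `sorry`.  HONEST FRAMING: `HC_CM` is
NOT proved; nothing here is a period or a headline.

CONTENT (`c` an involution, central where stated; `G = ⟨g⟩ ∪ c⟨g⟩`, `c ∉ ⟨g⟩`).
* §1 **The subgroup type** `sgp = [⟨g⟩] = {gⁱ}` (a CM type since `G = ⟨g⟩ ⊔ c⟨g⟩`), FIXED by `·g⁻¹` (`rt_sgp`, `rt_rt_sgp`); a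
  `·g`-invariant function on `G` takes the value `f 1` on `⟨g⟩` and `f c` on `c⟨g⟩` (`eq_or_eq_of_mul_invariant`).
* §2 **The augmentation submodule is `(·g⁻¹ − 1)𝔽₂[types] + pair2`**: a `c`-coboundary is a sum of pairs
  (`mapDomain_rt_self_sub_mem_pair2`), and `ker par2 ≤ range(·g⁻¹ − 1) + pair2` (`exists_sub_add_eq_of_par2_eq_zero`, with part V §3).
* §3 **The half-interval type** `hivl = Ψ_s = {gⁱ : i < m/2} ∪ {c·gⁱ : m/2 ≤ i < m}` (`m = ord g` even), with `Ψ_s·g^{−m/2} = Ψ̄_s`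
  (`rt_pow_half_hivl`), so its half block-sum telescopes to ONE pair (`exists_sub_eq_red_pair_of_split`).
* §4 `|G| = 2·ord g` (`card_eq_two_mul_orderOf_of_split`) and `δ = 1` when `ord g` is even (`wdelta_eq_one_of_split`, gen 28's transfer
  criterion: every `P` has `P^{ord g} = 1`).

## References
* [Pohlmann1968] H. Pohlmann, Algebraic cycles on abelian varieties of complex multiplication type, Ann. of Math. 88 (1968), Thm 1.
-/

namespace Summit.HodgeConjecture.CorCM.Census.Coinvariant

open Finset
open Summit.HodgeConjecture.CorCM.Prior.AllgGroup.RfwfAllgGroup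
open Summit.HodgeConjecture.CorCM.Census.BlockParity

noncomputable section

variable {G : Type*} [Group G] [Fintype G] [DecidableEq G] (c : G)

/-! ## §1 The subgroup type `[⟨g⟩]`, fixed by `·g⁻¹` -/

/-- **The subgroup type** `Ψ_A = ⟨g⟩ = {g^i : i < ord g}` (a CM type: `G = ⟨g⟩ ⊔ c⟨g⟩`). [folklore] -/
def sgp (hc2 : c * c = 1) {g : G} (hcov : ∀ Q : G, (∃ k : ℕ, Q = g ^ k) ∨ ∃ k : ℕ, Q = c * g ^ k)
    (hng : ∀ k : ℕ, c ≠ g ^ k) : CMF G c :=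
  ⟨(Finset.range (orderOf g)).image fun i => g ^ i, by
    have hmem : ∀ Q : G, Q ∈ (Finset.range (orderOf g)).image (fun i => g ^ i) ↔ ∃ k : ℕ, Q = g ^ k := by
      intro Q
      rw [Finset.mem_image]
      constructor
      · rintro ⟨i, -, rfl⟩; exact ⟨i, rfl⟩
      · rintro ⟨k, rfl⟩
        exact ⟨k % orderOf g, Finset.mem_range.mpr (Nat.mod_lt _ (orderOf_pos g)), pow_mod_orderOf g k⟩
    intro Q
    rw [hmem, hmem]
    constructor
    · rintro ⟨k, rfl⟩ ⟨j, hj⟩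
      apply hng (j + (orderOf g - k % orderOf g))
      have hk : g ^ k = g ^ (k % orderOf g) := (pow_mod_orderOf g k).symm
      calc c = c * g ^ k * g ^ (orderOf g - k % orderOf g) := by
            rw [hk, mul_assoc, ← pow_add, Nat.add_sub_cancel' (Nat.mod_lt _ (orderOf_pos g)).le, pow_orderOf_eq_one, mul_one]
        _ = g ^ (j + (orderOf g - k % orderOf g)) := by rw [hj, pow_add]
    · intro hQ
      rcases hcov Q with ⟨k, rfl⟩ | ⟨k, rfl⟩
      · exact ⟨k, rfl⟩
      · exact absurd ⟨k, by rw [← mul_assoc, hc2, one_mul]⟩ hQ⟩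

/-- Membership in the subgroup type: `Q ∈ [⟨g⟩] ↔ Q = g^k` for some `k`. [folklore] -/
theorem mem_sgp_iff (hc2 : c * c = 1) {g : G} (hcov : ∀ Q : G, (∃ k : ℕ, Q = g ^ k) ∨ ∃ k : ℕ, Q = c * g ^ k)
    (hng : ∀ k : ℕ, c ≠ g ^ k) (Q : G) : Q ∈ (sgp c hc2 hcov hng).1 ↔ ∃ k : ℕ, Q = g ^ k := by
  change Q ∈ (Finset.range (orderOf g)).image (fun i => g ^ i) ↔ _
  rw [Finset.mem_image]
  constructor
  · rintro ⟨i, -, rfl⟩; exact ⟨i, rfl⟩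
  · rintro ⟨k, rfl⟩
    exact ⟨k % orderOf g, Finset.mem_range.mpr (Nat.mod_lt _ (orderOf_pos g)), pow_mod_orderOf g k⟩

omit [DecidableEq G] in
/-- `c·gⁱ` is never a power of `g` (if `c` is not). [folklore] -/
theorem mul_pow_ne_pow_of_split {g : G} (hng : ∀ k : ℕ, c ≠ g ^ k) (i k : ℕ) : c * g ^ i ≠ g ^ k := by
  intro he
  apply hng (k + (orderOf g - i % orderOf g))
  have h1 : g ^ i * g ^ (orderOf g - i % orderOf g) = 1 := by
    rw [← pow_mod_orderOf g i, ← pow_add, Nat.add_sub_cancel' (Nat.mod_lt _ (orderOf_pos g)).le, pow_orderOf_eq_one]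
  calc c = c * (g ^ i * g ^ (orderOf g - i % orderOf g)) := by rw [h1, mul_one]
    _ = g ^ (k + (orderOf g - i % orderOf g)) := by rw [← mul_assoc, he, pow_add]

/-- **The subgroup type is fixed by `·g⁻¹`**: `⟨g⟩·g⁻¹ = ⟨g⟩`. [folklore] -/
theorem rt_sgp (hc2 : c * c = 1) {g : G} (hcov : ∀ Q : G, (∃ k : ℕ, Q = g ^ k) ∨ ∃ k : ℕ, Q = c * g ^ k)
    (hng : ∀ k : ℕ, c ≠ g ^ k) : rt c g (sgp c hc2 hcov hng) = sgp c hc2 hcov hng := by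
  apply Subtype.ext; ext Q
  rw [mem_rt, mem_sgp_iff, mem_sgp_iff]
  constructor
  · rintro ⟨k, hk⟩
    refine ⟨k + (orderOf g - 1), ?_⟩
    have h1 : 1 ≤ orderOf g := orderOf_pos g
    calc Q = Q * g * g ^ (orderOf g - 1) := by
          rw [mul_assoc, ← pow_succ', Nat.sub_add_cancel h1, pow_orderOf_eq_one, mul_one]
      _ = g ^ (k + (orderOf g - 1)) := by rw [hk, pow_add]
  · rintro ⟨k, rfl⟩; exact ⟨k + 1, by rw [pow_succ]⟩

/-- … and so is its conjugate `[c⟨g⟩]`. [folklore] -/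
theorem rt_rt_sgp (hc2 : c * c = 1) (hcen : ∀ x : G, x * c = c * x) {g : G}
    (hcov : ∀ Q : G, (∃ k : ℕ, Q = g ^ k) ∨ ∃ k : ℕ, Q = c * g ^ k) (hng : ∀ k : ℕ, c ≠ g ^ k) :
    rt c g (rt c c (sgp c hc2 hcov hng)) = rt c c (sgp c hc2 hcov hng) := by
  rw [← rt_mul, hcen g, rt_mul, rt_sgp]

/-- A `·g`-invariant function on `G = ⟨g⟩ ⊔ c⟨g⟩` takes only the values `f 1` (on `⟨g⟩`) and `f c` (on `c⟨g⟩`). [folklore] -/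
theorem eq_or_eq_of_mul_invariant (hc2 : c * c = 1) {g : G}
    (hcov : ∀ Q : G, (∃ k : ℕ, Q = g ^ k) ∨ ∃ k : ℕ, Q = c * g ^ k) (hng : ∀ k : ℕ, c ≠ g ^ k) {A : Type*} {f : G → A}
    (hf : ∀ P, f (P * g) = f P) (P : G) :
    (P ∈ (sgp c hc2 hcov hng).1 ∧ f P = f 1) ∨ (P ∉ (sgp c hc2 hcov hng).1 ∧ f P = f c) := by
  have hpow : ∀ (R : G) (k : ℕ), f (R * g ^ k) = f R := by
    intro R k
    induction k with
    | zero => rw [pow_zero, mul_one]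
    | succ k ih => rw [pow_succ, ← mul_assoc, hf, ih]
  rcases hcov P with ⟨k, rfl⟩ | ⟨k, rfl⟩
  · left
    exact ⟨(mem_sgp_iff c hc2 hcov hng _).mpr ⟨k, rfl⟩, by rw [← one_mul (g ^ k), hpow]⟩
  · right
    refine ⟨fun hm => ?_, hpow c k⟩
    exact ((sgp c hc2 hcov hng).2 (g ^ k)).mp ((mem_sgp_iff c hc2 hcov hng _).mpr ⟨k, rfl⟩) hm

/-! ## §2 The augmentation submodule is `(·g⁻¹ − 1)𝔽₂[types] + pair2` -/

/-- A `c`-coboundary is a sum of pairs: `z·c − z ∈ pair2`. [folklore] -/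
theorem mapDomain_rt_self_sub_mem_pair2 (z : CMF G c →₀ ZMod 2) : Finsupp.mapDomain (rt c c) z - z ∈ pair2 c := by
  induction z using Finsupp.induction_linear with
  | zero => rw [Finsupp.mapDomain_zero, sub_zero]; exact Submodule.zero_mem _
  | add f f' hf hf' =>
    have e : Finsupp.mapDomain (rt c c) (f + f') - (f + f') =
        (Finsupp.mapDomain (rt c c) f - f) + (Finsupp.mapDomain (rt c c) f' - f') := by rw [Finsupp.mapDomain_add]; abel
    rw [e]; exact Submodule.add_mem _ hf hf'
  | single Ψ a =>
    rw [Finsupp.mapDomain_single]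
    have e : Finsupp.single (rt c c Ψ) a - Finsupp.single Ψ a = a • red c (pair c Ψ) := by
      rw [red_pair, smul_add, Finsupp.smul_single_one, Finsupp.smul_single_one, sub_eq_add_neg, neg_eq_self_finsuppTwo, add_comm]
    rw [e]
    exact Submodule.smul_mem _ _ (red_mem_pair2 c (Submodule.subset_span (pair_mem_pairSet c Ψ)))

/-- **`ker par2 ≤ (·g⁻¹ − 1)𝔽₂[types] + pair2`** when `G = ⟨g⟩ ⊔ c⟨g⟩`. [folklore] -/
theorem exists_sub_add_eq_of_par2_eq_zero (hcen : ∀ x : G, x * c = c * x) {g : G}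
    (hcov : ∀ Q : G, (∃ k : ℕ, Q = g ^ k) ∨ ∃ k : ℕ, Q = c * g ^ k) {x : CMF G c →₀ ZMod 2} (hx : par2 c x = 0) :
    ∃ (z : CMF G c →₀ ZMod 2) (p : CMF G c →₀ ZMod 2), p ∈ pair2 c ∧ Finsupp.mapDomain (rt c g) z - z + p = x := by
  set D : (CMF G c →₀ ZMod 2) →ₗ[ZMod 2] (CMF G c →₀ ZMod 2) := Finsupp.lmapDomain (ZMod 2) (ZMod 2) (rt c g) - LinearMap.id
    with hD
  have hDap : ∀ z, D z = Finsupp.mapDomain (rt c g) z - z := fun z => rfl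
  suffices hmem : x ∈ LinearMap.range D ⊔ pair2 c by
    obtain ⟨y, hy, p, hp, hyp⟩ := Submodule.mem_sup.mp hmem
    obtain ⟨z, rfl⟩ := LinearMap.mem_range.mp hy
    exact ⟨z, p, hp, by rw [← hDap]; exact hyp⟩
  have hpow : ∀ (k : ℕ) (z : CMF G c →₀ ZMod 2), Finsupp.mapDomain (rt c (g ^ k)) z - z ∈ LinearMap.range D := by
    intro k z
    induction k with
    | zero => rw [pow_zero, mapDomain_rt_one, sub_self]; exact Submodule.zero_mem _
    | succ k ih =>
      have e : Finsupp.mapDomain (rt c (g ^ (k + 1))) z - z =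
          D (Finsupp.mapDomain (rt c (g ^ k)) z) + (Finsupp.mapDomain (rt c (g ^ k)) z - z) := by
        rw [hDap, ← mapDomain_rt_mul, pow_succ']; abel
      rw [e]
      exact Submodule.add_mem _ (LinearMap.mem_range_self D _) ih
  have hle : Submodule.span (ZMod 2)
      {y : CMF G c →₀ ZMod 2 | ∃ (Q : G) (z : CMF G c →₀ ZMod 2), y = Finsupp.mapDomain (rt c Q) z - z} ≤
      LinearMap.range D ⊔ pair2 c := by
    rw [Submodule.span_le]
    rintro _ ⟨Q, z, rfl⟩
    rcases hcov Q with ⟨k, rfl⟩ | ⟨k, rfl⟩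
    · exact Submodule.mem_sup_left (hpow k z)
    · have e : Finsupp.mapDomain (rt c (c * g ^ k)) z - z =
          (Finsupp.mapDomain (rt c (g ^ k)) (Finsupp.mapDomain (rt c c) z) - Finsupp.mapDomain (rt c c) z) +
            (Finsupp.mapDomain (rt c c) z - z) := by
        rw [show c * g ^ k = g ^ k * c from (hcen (g ^ k)).symm, mapDomain_rt_mul]; abel
      rw [SetLike.mem_coe, e]
      exact Submodule.add_mem _ (Submodule.mem_sup_left (hpow k _))
        (Submodule.mem_sup_right (mapDomain_rt_self_sub_mem_pair2 c z))
  exact hle (mem_span_cobdryAll_of_par2_eq_zero c hx)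

/-! ## §3 The half-interval type and its telescoping half block-sum -/

/-- **The half-interval type** `Ψ_s = {gⁱ : i < m/2} ∪ {c·gⁱ : m/2 ≤ i < m}` (`m = ord g` even). [folklore] -/
def hivl (hc2 : c * c = 1) {g : G} (hcov : ∀ Q : G, (∃ k : ℕ, Q = g ^ k) ∨ ∃ k : ℕ, Q = c * g ^ k)
    (hng : ∀ k : ℕ, c ≠ g ^ k) (hm : Even (orderOf g)) : CMF G c :=
  ⟨((Finset.range (orderOf g / 2)).image fun i => g ^ i) ∪
      ((Finset.range (orderOf g)).filter (fun i => orderOf g / 2 ≤ i)).image (fun i => c * g ^ i), by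
    obtain ⟨m', hm'⟩ := hm
    set m := orderOf g with hmdef
    have hm2 : m / 2 = m' := by omega
    have hgk : ∀ k : ℕ, g ^ k ∈ ((Finset.range (m / 2)).image fun i => g ^ i) ∪
        ((Finset.range m).filter (fun i => m / 2 ≤ i)).image (fun i => c * g ^ i) ↔ k % m < m / 2 := by
      intro k
      rw [Finset.mem_union, Finset.mem_image, Finset.mem_image]
      constructor
      · rintro (⟨i, hi, he⟩ | ⟨i, -, he⟩)
        · rw [Finset.mem_range] at hi
          have := pow_eq_pow_iff_modEq.mp he
          rw [← hmdef, Nat.ModEq, Nat.mod_eq_of_lt (by omega : i < m)] at this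
          omega
        · exact absurd he (mul_pow_ne_pow_of_split c hng i k)
      · intro hk
        exact Or.inl ⟨k % m, Finset.mem_range.mpr hk, pow_mod_orderOf g k⟩
    have hcgk : ∀ k : ℕ, c * g ^ k ∈ ((Finset.range (m / 2)).image fun i => g ^ i) ∪
        ((Finset.range m).filter (fun i => m / 2 ≤ i)).image (fun i => c * g ^ i) ↔ m / 2 ≤ k % m := by
      intro k
      rw [Finset.mem_union, Finset.mem_image, Finset.mem_image]
      constructor
      · rintro (⟨i, -, he⟩ | ⟨i, hi, he⟩)
        · exact absurd he.symm (mul_pow_ne_pow_of_split c hng k i)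
        · rw [Finset.mem_filter, Finset.mem_range] at hi
          have he' : g ^ i = g ^ k := mul_left_cancel he
          have := pow_eq_pow_iff_modEq.mp he'
          rw [← hmdef, Nat.ModEq, Nat.mod_eq_of_lt (by omega : i < m)] at this
          omega
      · intro hk
        refine Or.inr ⟨k % m, Finset.mem_filter.mpr ⟨Finset.mem_range.mpr (Nat.mod_lt _ (orderOf_pos g)), hk⟩, ?_⟩
        rw [pow_mod_orderOf]
    intro Q
    rcases hcov Q with ⟨k, rfl⟩ | ⟨k, rfl⟩
    · rw [hgk, hcgk]; omega
    · rw [hcgk, ← mul_assoc, hc2, one_mul, hgk]; omega⟩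

/-- **`Ψ_s·g^{−m/2} = Ψ̄_s`**: translating the half-interval type half-way round gives its conjugate. [folklore] -/
theorem rt_pow_half_hivl (hc2 : c * c = 1) (hcen : ∀ x : G, x * c = c * x) {g : G}
    (hcov : ∀ Q : G, (∃ k : ℕ, Q = g ^ k) ∨ ∃ k : ℕ, Q = c * g ^ k) (hng : ∀ k : ℕ, c ≠ g ^ k) (hm : Even (orderOf g)) :
    rt c (g ^ (orderOf g / 2)) (hivl c hc2 hcov hng hm) = rt c c (hivl c hc2 hcov hng hm) := by
  obtain ⟨m', hm'⟩ := hm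
  set m := orderOf g with hmdef
  have hm2 : m / 2 = m' := by omega
  have hmpos : 0 < m := orderOf_pos g
  -- membership criteria (restated from the definition)
  have hgk : ∀ k : ℕ, g ^ k ∈ (hivl c hc2 hcov hng ⟨m', hm'⟩).1 ↔ k % m < m / 2 := by
    intro k
    have hc' := (hivl c hc2 hcov hng ⟨m', hm'⟩).2
    -- decide membership through the CM-type property and the explicit generators
    constructor
    · intro hk
      by_contra hge
      push Not at hge
      have hmem : c * g ^ k ∈ (hivl c hc2 hcov hng ⟨m', hm'⟩).1 := by
        change c * g ^ k ∈ ((Finset.range (m / 2)).image fun i => g ^ i) ∪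
          ((Finset.range m).filter (fun i => m / 2 ≤ i)).image (fun i => c * g ^ i)
        rw [Finset.mem_union]
        refine Or.inr (Finset.mem_image.mpr
          ⟨k % m, Finset.mem_filter.mpr ⟨Finset.mem_range.mpr (Nat.mod_lt _ hmpos), hge⟩, ?_⟩)
        rw [pow_mod_orderOf]
      exact ((hc' (g ^ k)).mp hk) hmem
    · intro hk
      change g ^ k ∈ ((Finset.range (m / 2)).image fun i => g ^ i) ∪
        ((Finset.range m).filter (fun i => m / 2 ≤ i)).image (fun i => c * g ^ i)
      rw [Finset.mem_union]
      exact Or.inl (Finset.mem_image.mpr ⟨k % m, Finset.mem_range.mpr hk, pow_mod_orderOf g k⟩)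
  have hcgk : ∀ k : ℕ, c * g ^ k ∈ (hivl c hc2 hcov hng ⟨m', hm'⟩).1 ↔ m / 2 ≤ k % m := by
    intro k
    have h2 := (hivl c hc2 hcov hng ⟨m', hm'⟩).2 (c * g ^ k)
    rw [← mul_assoc, hc2, one_mul, hgk] at h2
    rw [h2, Nat.not_lt]
  apply Subtype.ext; ext Q
  rw [mem_rt, mem_rt]
  rcases hcov Q with ⟨k, rfl⟩ | ⟨k, rfl⟩
  · rw [← pow_add, hgk, hcen, hcgk]
    have e1 : (k + m / 2) % m = (k % m + m / 2) % m := by rw [Nat.add_mod, Nat.mod_eq_of_lt (by omega : m / 2 < m)]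
    rw [e1]
    have hk2 : k % m < m := Nat.mod_lt _ hmpos
    by_cases hlt : k % m < m / 2
    · rw [Nat.mod_eq_of_lt (by omega)]; omega
    · rw [Nat.mod_eq_sub_mod (by omega), Nat.mod_eq_of_lt (by omega)]; omega
  · rw [mul_assoc, ← pow_add, hcgk, hcen, ← mul_assoc, hc2, one_mul, hgk]
    have e1 : (k + m / 2) % m = (k % m + m / 2) % m := by rw [Nat.add_mod, Nat.mod_eq_of_lt (by omega : m / 2 < m)]
    rw [e1]
    have hk2 : k % m < m := Nat.mod_lt _ hmpos
    by_cases hlt : k % m < m / 2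
    · rw [Nat.mod_eq_of_lt (by omega)]; omega
    · rw [Nat.mod_eq_sub_mod (by omega), Nat.mod_eq_of_lt (by omega)]; omega

/-- **Telescoping**: `s = Σ_{k<m/2} [Ψ_s·g^{−k}]` has `s·g⁻¹ − s = [Ψ_s] + [Ψ̄_s]`, ONE pair. [folklore] -/
theorem exists_sub_eq_red_pair_of_split (hc2 : c * c = 1) (hcen : ∀ x : G, x * c = c * x) {g : G} (hcov : ∀ Q : G, (∃ k : ℕ, Q = g ^ k) ∨ ∃ k : ℕ, Q = c * g ^ k)
    (hng : ∀ k : ℕ, c ≠ g ^ k)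
    (hm : Even (orderOf g)) :
    ∃ s : CMF G c →₀ ZMod 2, Finsupp.mapDomain (rt c g) s - s = red c (pair c (hivl c hc2 hcov hng hm)) := by
  set Ψ₀ := hivl c hc2 hcov hng hm
  refine ⟨∑ k ∈ Finset.range (orderOf g / 2), Finsupp.single (rt c (g ^ k) Ψ₀) 1, ?_⟩
  rw [Finsupp.mapDomain_finsetSum]
  simp only [Finsupp.mapDomain_single]
  have e : ∀ k, rt c g (rt c (g ^ k) Ψ₀) = rt c (g ^ (k + 1)) Ψ₀ := fun k => by rw [← rt_mul, ← pow_succ']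
  simp only [e]
  rw [← Finset.sum_sub_distrib, Finset.sum_range_sub (fun k => Finsupp.single (rt c (g ^ k) Ψ₀) (1 : ZMod 2)), pow_zero,
    rt_one, rt_pow_half_hivl c hc2 hcen hcov hng hm, red_pair, sub_eq_add_neg, neg_eq_self_finsuppTwo, add_comm]

/-! ## §4 `|G| = 2·ord g` and `δ = 1` -/

/-- In the split-cyclic case `|G| = 2·ord g`. [folklore] -/
theorem card_eq_two_mul_orderOf_of_split {g : G} (hcov : ∀ Q : G, (∃ k : ℕ, Q = g ^ k) ∨ ∃ k : ℕ, Q = c * g ^ k)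
    (hng : ∀ k : ℕ, c ≠ g ^ k) : Fintype.card G = 2 * orderOf g := by
  classical
  set A : Finset G := (Finset.range (orderOf g)).image fun i => g ^ i with hA
  have hAcard : A.card = orderOf g := by
    rw [hA, Finset.card_image_of_injOn, Finset.card_range]
    intro i hi j hj hij
    rw [Finset.coe_range, Set.mem_Iio] at hi hj
    exact pow_injOn_Iio_orderOf hi hj hij
  have hcA : (A.image fun x => c * x).card = orderOf g := by
    rw [Finset.card_image_of_injective _ (mul_right_injective c), hAcard]
  have hdisj : Disjoint A (A.image fun x => c * x) := by
    rw [Finset.disjoint_left]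
    rintro _ hx hcx
    obtain ⟨i, -, rfl⟩ := Finset.mem_image.mp hx
    obtain ⟨_, hy, he⟩ := Finset.mem_image.mp hcx
    obtain ⟨j, -, rfl⟩ := Finset.mem_image.mp hy
    exact mul_pow_ne_pow_of_split c hng j i he
  have huniv : A ∪ A.image (fun x => c * x) = Finset.univ := by
    refine Finset.eq_univ_of_forall fun Q => ?_
    rw [Finset.mem_union]
    rcases hcov Q with ⟨k, rfl⟩ | ⟨k, rfl⟩
    · exact Or.inl (Finset.mem_image.mpr
        ⟨k % orderOf g, Finset.mem_range.mpr (Nat.mod_lt _ (orderOf_pos g)), pow_mod_orderOf g k⟩)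
    · exact Or.inr (Finset.mem_image.mpr ⟨g ^ k, Finset.mem_image.mpr
        ⟨k % orderOf g, Finset.mem_range.mpr (Nat.mod_lt _ (orderOf_pos g)), pow_mod_orderOf g k⟩, rfl⟩)
  rw [← Finset.card_univ, ← huniv, Finset.card_union_of_disjoint hdisj, hAcard, hcA]
  ring

/-- In the split-cyclic case every element satisfies `P^{|G|/2} = 1`, so `δ = 1`. [folklore] -/
theorem wdelta_eq_one_of_split (hc2 : c * c = 1) (hc1 : c ≠ 1) (hcen : ∀ x : G, x * c = c * x) {g : G} (hcov : ∀ Q : G, (∃ k : ℕ, Q = g ^ k) ∨ ∃ k : ℕ, Q = c * g ^ k)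
    (hng : ∀ k : ℕ, c ≠ g ^ k)
    (hm : Even (orderOf g)) (T₀ : CMF G c) : wdelta c T₀ = 1 := by
  rw [wdelta_eq_one_iff c hc2 hc1 hcen T₀, card_eq_two_mul_orderOf_of_split c hcov hng]
  have hdiv : 2 * orderOf g / 2 = orderOf g := by omega
  rw [hdiv]
  obtain ⟨m', hm'⟩ := hm
  have hcm : c ^ orderOf g = 1 := by rw [hm', ← two_mul, pow_mul, pow_two, hc2, one_pow]
  intro P
  rcases hcov P with ⟨k, rfl⟩ | ⟨k, rfl⟩
  · rw [← pow_mul, mul_comm, pow_mul, pow_orderOf_eq_one, one_pow]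
  · rw [(Commute.symm (hcen (g ^ k)) : Commute c (g ^ k)).mul_pow, hcm, one_mul, ← pow_mul, mul_comm, pow_mul,
      pow_orderOf_eq_one, one_pow]

end

end Summit.HodgeConjecture.CorCM.Census.Coinvariant
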